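import Summits.KontsevichZagierPeriods.KontsevichZagierPeriods.Theses.LinRedNormalForm
import Literature.NumberTheory.Transcendental.KZCalculusProofs

/-!
# `DihedralNormalForm` (stmt-KontsevichZagierPeriods-3912): negative side — rule (1b) is derivable from (1a) + (3)

Landed copy of §6 of the crux work file `Cruxes/DihedralNormalForm/Disproof.lean` (cdisprove seat,
generation 3).  Part of the LOAD-BEARING ANALYSIS of the four Kontsevich–Zagier move sets for the
crux `DihedralNormalForm` (route `LinRedNormalForm`): which rules must any move-chain use, and —
dually — against which rules must a candidate additive invariant finer than `KZ.eval` (the shape of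
any refutation of the crux, `Core.lean`) be tested.  Rules (3) and (2) are load-bearing
(`LoadBearing.lean` and the work file); this file shows that rule (1b), integrand additivity, is
NEVER load-bearing, because it is a consequence of domain additivity (1a) and Newton–Leibniz (3)
inside the typed calculus:

* `integrandAddRel_subset_closure` — `KZ.integrandAddRel ⊆ closure(KZ.domainAddRel ∪
  KZ.newtonLeibnizRel)`.  Construction: given `f = f₁ + f₂` on `σ`, the MIXING BAND
  `[σ × [0,2], h]`, `h(x,t) = f₁(x)(3/2 − t) + f₂(x)(t − 1/2)` (so that `∫₀¹ h dt = f₁`,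
  `∫₁² h dt = f₂`, `∫₀² h dt = f₁ + f₂`, with the polynomial primitive `mixPrim`), descends by one
  Newton–Leibniz move to `[σ, f₁ + f₂]`, splits by one domain-additivity move along the null
  hyperplane `t = 1`, and the two unit slabs descend by Newton–Leibniz moves to `[σ, f₁]`, `[σ, f₂]`;
  all side conditions (semialgebraicity by the tree facts `add_holds`/`mul_holds`, integrability
  by `integrableOn_slabDomain` and boundedness of the polynomial factor) are discharged;
* `relations_eq_closure_three` — hence `KZ.relations = closure((1a) ∪ (2) ∪ (3))`.

Consequence recorded for the other seats: an additive invariant of the calculus is determined by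
its behaviour on (1a), (2), (3); no "integrand-additivity-free" sub-calculus is a meaningful
restriction.  [Kontsevich–Zagier 2001, §1.2, rules (1)–(3)] -/

noncomputable section

open MeasureTheory Set MvPolynomial
open Literature.NumberTheory.Transcendental

namespace Summit.KontsevichZagierPeriods.DihedralNormalForm.Negative

variable {n : ℕ}

/-- A coordinate hyperplane `{z | z i = c}` of `ℝⁿ⁺¹` is Lebesgue-null. [folklore] -/
theorem volume_setOf_apply_eq (i : Fin (n + 1)) (c : ℝ) :
    volume {z : Fin (n + 1) → ℝ | z i = c} = 0 := by
  have h : {z : Fin (n + 1) → ℝ | z i = c} = Set.pi univ (fun j => if j = i then {c} else univ) := by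
    ext z
    simp only [mem_setOf_eq, mem_pi, mem_univ, true_implies]
    constructor
    · intro hz j
      split_ifs with hj
      · subst hj; simpa using hz
      · trivial
    · intro hz
      simpa using hz i
  rw [h, volume_pi_pi]
  apply Finset.prod_eq_zero (Finset.mem_univ i)
  simp

section Mix

variable (r₁ r₂ : KZ.IntegralRep n) (h₁₂ : r₂.domain = r₁.domain)

/-- The mixing integrand `h(x,t) = f₁(x)(3/2 - t) + f₂(x)(t - 1/2)` on `σ × [0,2]`:
`∫₀¹ h dt = f₁`, `∫₁² h dt = f₂`, `∫₀² h dt = f₁ + f₂`. -/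
def mixFun (z : Fin (n + 1) → ℝ) : ℝ :=
  r₁.integrand (Fin.init z) * (3 / 2 - z (Fin.last n)) +
    r₂.integrand (Fin.init z) * (z (Fin.last n) - 1 / 2)

/-- Its fibrewise (polynomial in `t`) primitive. -/
def mixPrim (z : Fin (n + 1) → ℝ) : ℝ :=
  r₁.integrand (Fin.init z) * (3 / 2 * z (Fin.last n) - z (Fin.last n) ^ 2 / 2) +
    r₂.integrand (Fin.init z) * (z (Fin.last n) ^ 2 / 2 - z (Fin.last n) / 2)

/-- The band `σ × [0,2]` as the union of the two unit slabs. -/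
def bigBand : Set (Fin (n + 1) → ℝ) := r₁.slabDomain 0 ∪ r₁.slabDomain 1

/-- The union of the two unit slabs is the band `σ × [0,2]`. [folklore] -/
theorem bigBand_eq : bigBand r₁ =
    {z | (Fin.init z : Fin n → ℝ) ∈ r₁.domain ∧ (0 : ℝ) ≤ z (Fin.last n) ∧ z (Fin.last n) ≤ 2} := by
  ext z
  simp only [bigBand, KZ.IntegralRep.slabDomain, mem_union, mem_setOf_eq, Nat.cast_zero,
    Nat.cast_one]
  constructor
  · rintro (⟨h, h0, h1⟩ | ⟨h, h0, h1⟩) <;> exact ⟨h, by linarith, by linarith⟩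
  · rintro ⟨h, h0, h2⟩
    by_cases hz : z (Fin.last n) ≤ 1
    · exact Or.inl ⟨h, h0, by linarith⟩
    · exact Or.inr ⟨h, by linarith, by linarith⟩

/-- Points of the big band lie over `σ`. [folklore] -/
theorem init_mem_of_mem_bigBand {z : Fin (n + 1) → ℝ} (hz : z ∈ bigBand r₁) :
    (Fin.init z : Fin n → ℝ) ∈ r₁.domain := by
  rcases hz with h | h <;> exact h.1

include h₁₂ in
/-- The mixing integrand is `ℚ`-semialgebraic on every `ℚ`-semialgebraic set over `σ`
(Tarski–Seidenberg for sums and products, tree facts `add_holds`, `mul_holds`). [folklore] -/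
theorem isSemialgebraicFunOn_mixFun {S : Set (Fin (n + 1) → ℝ)}
    (hS : Literature.ModelTheory.ExponentialFields.IsSemialgebraic ℚ S)
    (hsub : ∀ z ∈ S, (Fin.init z : Fin n → ℝ) ∈ r₁.domain) : IsSemialgebraicFunOn ℚ S (mixFun r₁ r₂) := by
  have hf₁ : IsSemialgebraicFunOn ℚ S (fun z => r₁.integrand (Fin.init z)) :=
    r₁.isSemialgebraicFunOn_integrand.comp_init.mono (fun z hz => hsub z hz) hS
  have hf₂ : IsSemialgebraicFunOn ℚ S (fun z => r₂.integrand (Fin.init z)) :=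
    r₂.isSemialgebraicFunOn_integrand.comp_init.mono
      (fun z hz => by show (Fin.init z : Fin n → ℝ) ∈ r₂.domain; rw [h₁₂]; exact hsub z hz) hS
  have hp₁ : IsSemialgebraicFunOn ℚ S (fun z => (3 / 2 : ℝ) - z (Fin.last n)) :=
    (isSemialgebraicFunOn_aeval hS (C (3 / 2 : ℚ) - X (Fin.last n))).congr fun z _ => by
      simp only [map_sub, aeval_C, aeval_X, eq_ratCast]; push_cast; ring
  have hp₂ : IsSemialgebraicFunOn ℚ S (fun z => z (Fin.last n) - (1 / 2 : ℝ)) :=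
    (isSemialgebraicFunOn_aeval hS (X (Fin.last n) - C (1 / 2 : ℚ))).congr fun z _ => by
      simp only [map_sub, aeval_C, aeval_X, eq_ratCast]; push_cast; ring
  exact IsSemialgebraicFunOn.add_holds (IsSemialgebraicFunOn.mul_holds hf₁ hp₁)
    (IsSemialgebraicFunOn.mul_holds hf₂ hp₂)

include h₁₂ in
/-- The primitive is `ℚ`-semialgebraic likewise. [folklore] -/
theorem isSemialgebraicFunOn_mixPrim {S : Set (Fin (n + 1) → ℝ)}
    (hS : Literature.ModelTheory.ExponentialFields.IsSemialgebraic ℚ S)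
    (hsub : ∀ z ∈ S, (Fin.init z : Fin n → ℝ) ∈ r₁.domain) : IsSemialgebraicFunOn ℚ S (mixPrim r₁ r₂) := by
  have hf₁ : IsSemialgebraicFunOn ℚ S (fun z => r₁.integrand (Fin.init z)) :=
    r₁.isSemialgebraicFunOn_integrand.comp_init.mono (fun z hz => hsub z hz) hS
  have hf₂ : IsSemialgebraicFunOn ℚ S (fun z => r₂.integrand (Fin.init z)) :=
    r₂.isSemialgebraicFunOn_integrand.comp_init.mono
      (fun z hz => by show (Fin.init z : Fin n → ℝ) ∈ r₂.domain; rw [h₁₂]; exact hsub z hz) hS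
  have hp₁ : IsSemialgebraicFunOn ℚ S
      (fun z => (3 / 2 : ℝ) * z (Fin.last n) - z (Fin.last n) ^ 2 / 2) :=
    (isSemialgebraicFunOn_aeval hS
      (C (3 / 2 : ℚ) * X (Fin.last n) - C (1 / 2 : ℚ) * X (Fin.last n) ^ 2)).congr fun z _ => by
      simp only [map_sub, map_mul, map_pow, aeval_C, aeval_X, eq_ratCast]; push_cast; ring
  have hp₂ : IsSemialgebraicFunOn ℚ S
      (fun z => z (Fin.last n) ^ 2 / 2 - z (Fin.last n) / 2) :=
    (isSemialgebraicFunOn_aeval hS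
      (C (1 / 2 : ℚ) * X (Fin.last n) ^ 2 - C (1 / 2 : ℚ) * X (Fin.last n))).congr fun z _ => by
      simp only [map_sub, map_mul, map_pow, aeval_C, aeval_X, eq_ratCast]; push_cast; ring
  exact IsSemialgebraicFunOn.add_holds (IsSemialgebraicFunOn.mul_holds hf₁ hp₁)
    (IsSemialgebraicFunOn.mul_holds hf₂ hp₂)

include h₁₂ in
/-- Representations with the same domain have the same slabs. [folklore] -/
theorem slabDomain_eq (j : ℕ) : r₂.slabDomain j = r₁.slabDomain j := by
  simp only [KZ.IntegralRep.slabDomain, h₁₂]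

include h₁₂ in
/-- The mixing integrand is absolutely integrable on each slab `σ × [j, j+1]`, `j ≤ 1`
(integrable factor times a bounded polynomial). [folklore] -/
theorem integrableOn_mixFun_slab (j : ℕ) (hj : j ≤ 1) :
    IntegrableOn (mixFun r₁ r₂) (r₁.slabDomain j) := by
  have hm : MeasurableSet (r₁.slabDomain j) :=
    Literature.ModelTheory.ExponentialFields.IsSemialgebraic.measurableSet_holds
      (r₁.isSemialgebraic_slabDomain j)
  have hI₁ : IntegrableOn (fun z : Fin (n + 1) → ℝ => r₁.integrand (Fin.init z))
      (r₁.slabDomain j) := r₁.integrableOn_slabDomain j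
  have hI₂ : IntegrableOn (fun z : Fin (n + 1) → ℝ => r₂.integrand (Fin.init z))
      (r₁.slabDomain j) := slabDomain_eq r₁ r₂ h₁₂ j ▸ r₂.integrableOn_slabDomain j
  have hj' : (j : ℝ) ≤ 1 := by exact_mod_cast hj
  have hb₁ : ∀ᵐ z ∂(volume.restrict (r₁.slabDomain j)),
      ‖(3 / 2 : ℝ) - z (Fin.last n)‖ ≤ 4 := by
    rw [ae_restrict_iff' hm]
    refine ae_of_all _ fun z hz => ?_
    obtain ⟨-, hz1, hz2⟩ := hz
    rw [Real.norm_eq_abs, abs_le]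
    constructor <;> linarith
  have hb₂ : ∀ᵐ z ∂(volume.restrict (r₁.slabDomain j)),
      ‖z (Fin.last n) - (1 / 2 : ℝ)‖ ≤ 4 := by
    rw [ae_restrict_iff' hm]
    refine ae_of_all _ fun z hz => ?_
    obtain ⟨-, hz1, hz2⟩ := hz
    rw [Real.norm_eq_abs, abs_le]
    constructor <;> linarith
  have hc₁ : AEStronglyMeasurable (fun z : Fin (n + 1) → ℝ => (3 / 2 : ℝ) - z (Fin.last n))
      (volume.restrict (r₁.slabDomain j)) :=
    (continuous_const.sub (continuous_apply _)).aestronglyMeasurable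
  have hc₂ : AEStronglyMeasurable (fun z : Fin (n + 1) → ℝ => z (Fin.last n) - (1 / 2 : ℝ))
      (volume.restrict (r₁.slabDomain j)) :=
    ((continuous_apply _).sub continuous_const).aestronglyMeasurable
  exact (Integrable.mul_bdd hI₁ hc₁ hb₁).add (Integrable.mul_bdd hI₂ hc₂ hb₂)

/-- The mixing representation on the big band `σ × [0,2]`. -/
def mixRep : KZ.IntegralRep (n + 1) where
  domain := bigBand r₁
  integrand := mixFun r₁ r₂
  isSemialgebraic_domain := (r₁.isSemialgebraic_slabDomain 0).union (r₁.isSemialgebraic_slabDomain 1)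
  isSemialgebraicFunOn_integrand :=
    isSemialgebraicFunOn_mixFun r₁ r₂ h₁₂
      ((r₁.isSemialgebraic_slabDomain 0).union (r₁.isSemialgebraic_slabDomain 1))
      (fun _ hz => init_mem_of_mem_bigBand r₁ hz)
  integrableOn :=
    (integrableOn_mixFun_slab r₁ r₂ h₁₂ 0 (by norm_num)).union
      (integrableOn_mixFun_slab r₁ r₂ h₁₂ 1 le_rfl)

/-- The mixing representation on the slab `σ × [j, j+1]`. -/
def mixSlab (j : ℕ) (hj : j ≤ 1) : KZ.IntegralRep (n + 1) where
  domain := r₁.slabDomain j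
  integrand := mixFun r₁ r₂
  isSemialgebraic_domain := r₁.isSemialgebraic_slabDomain j
  isSemialgebraicFunOn_integrand :=
    isSemialgebraicFunOn_mixFun r₁ r₂ h₁₂ (r₁.isSemialgebraic_slabDomain j) (fun _ hz => hz.1)
  integrableOn := integrableOn_mixFun_slab r₁ r₂ h₁₂ j hj

/-- Fibrewise derivative of the primitive. [folklore] -/
theorem hasDerivAt_mixPrim (x : Fin n → ℝ) (t : ℝ) :
    HasDerivAt (fun s : ℝ => mixPrim r₁ r₂ (Fin.snoc x s)) (mixFun r₁ r₂ (Fin.snoc x t)) t := by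
  simp only [mixPrim, mixFun, Fin.init_snoc, Fin.snoc_last]
  have h1 : HasDerivAt (fun s : ℝ => 3 / 2 * s - s ^ 2 / 2) (3 / 2 * 1 - (2 : ℕ) * t ^ (2 - 1) * 1 / 2) t :=
    ((hasDerivAt_id t).const_mul (3 / 2)).sub (((hasDerivAt_id t).pow 2).div_const 2)
  have h2 : HasDerivAt (fun s : ℝ => s ^ 2 / 2 - s / 2) ((2 : ℕ) * t ^ (2 - 1) * 1 / 2 - 1 / 2) t :=
    (((hasDerivAt_id t).pow 2).div_const 2).sub ((hasDerivAt_id t).div_const 2)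
  refine ((h1.const_mul (r₁.integrand x)).add (h2.const_mul (r₂.integrand x))).congr_deriv ?_
  push_cast
  ring

/-- `[mixSlab 0] − [r₁]` is one Newton–Leibniz move (`∫₀¹ h dt = f₁`). [folklore] -/
theorem of_mixSlab_zero_sub_mem :
    KZ.of (mixSlab r₁ r₂ h₁₂ 0 (by norm_num)) - KZ.of r₁ ∈ KZ.newtonLeibnizRel := by
  refine ⟨n, mixSlab r₁ r₂ h₁₂ 0 (by norm_num), r₁, fun _ => ((0 : ℕ) : ℝ), fun _ => ((0 : ℕ) : ℝ) + 1,
    mixPrim r₁ r₂, ?_, isSemialgebraicFunOn_natCast r₁.isSemialgebraic_domain 0, ?_,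
    fun _ _ => by norm_num, rfl, ?_, ?_, ?_, rfl⟩
  · exact isSemialgebraicFunOn_mixPrim r₁ r₂ h₁₂ (r₁.isSemialgebraic_slabDomain 0) (fun _ hz => hz.1)
  · exact (isSemialgebraicFunOn_aeval r₁.isSemialgebraic_domain
      (((0 : ℕ) : MvPolynomial (Fin n) ℚ) + 1)).congr fun x _ => by simp
  · intro x _
    simp only [mixPrim, Fin.snoc_last, Fin.init_snoc]
    fun_prop
  · intro x _ t _
    exact hasDerivAt_mixPrim r₁ r₂ x t
  · intro x _
    simp only [mixPrim, Fin.snoc_last, Fin.init_snoc]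
    push_cast
    ring

/-- `[mixSlab 1] − [r₂]` is one Newton–Leibniz move (`∫₁² h dt = f₂`). [folklore] -/
theorem of_mixSlab_one_sub_mem :
    KZ.of (mixSlab r₁ r₂ h₁₂ 1 le_rfl) - KZ.of r₂ ∈ KZ.newtonLeibnizRel := by
  refine ⟨n, mixSlab r₁ r₂ h₁₂ 1 le_rfl, r₂, fun _ => ((1 : ℕ) : ℝ), fun _ => ((1 : ℕ) : ℝ) + 1,
    mixPrim r₁ r₂, ?_, isSemialgebraicFunOn_natCast r₂.isSemialgebraic_domain 1, ?_,
    fun _ _ => by norm_num, ?_, ?_, ?_, ?_, rfl⟩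
  · exact isSemialgebraicFunOn_mixPrim r₁ r₂ h₁₂ (r₁.isSemialgebraic_slabDomain 1) (fun _ hz => hz.1)
  · exact (isSemialgebraicFunOn_aeval r₂.isSemialgebraic_domain
      (((1 : ℕ) : MvPolynomial (Fin n) ℚ) + 1)).congr fun x _ => by simp
  · show r₁.slabDomain 1 = _
    rw [← slabDomain_eq r₁ r₂ h₁₂ 1]
    rfl
  · intro x _
    simp only [mixPrim, Fin.snoc_last, Fin.init_snoc]
    fun_prop
  · intro x _ t _
    exact hasDerivAt_mixPrim r₁ r₂ x t
  · intro x _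
    simp only [mixPrim, Fin.snoc_last, Fin.init_snoc]
    push_cast
    ring

/-- `[mixRep] − [mixSlab 0] − [mixSlab 1]` is one domain-additivity move (cut at `t = 1`, a
null hyperplane). [folklore] -/
theorem of_mixRep_sub_sub_mem :
    KZ.of (mixRep r₁ r₂ h₁₂) - KZ.of (mixSlab r₁ r₂ h₁₂ 0 (by norm_num)) -
      KZ.of (mixSlab r₁ r₂ h₁₂ 1 le_rfl) ∈ KZ.domainAddRel := by
  refine ⟨n + 1, mixRep r₁ r₂ h₁₂, mixSlab r₁ r₂ h₁₂ 0 (by norm_num), mixSlab r₁ r₂ h₁₂ 1 le_rfl,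
    rfl, ?_, fun _ _ => rfl, fun _ _ => rfl, rfl⟩
  refine measure_mono_null (fun z hz => ?_) (volume_setOf_apply_eq (Fin.last n) 1)
  obtain ⟨⟨-, -, h0⟩, ⟨-, h1, -⟩⟩ := hz
  simp only [Nat.cast_zero, zero_add, Nat.cast_one] at h0 h1
  exact le_antisymm h0 h1

end Mix

/-- **Rule (1b) is derivable from rules (1a) and (3).** Given `f = f₁ + f₂` on `σ`, the mixing
band `[σ × [0,2], f₁(x)(3/2 - t) + f₂(x)(t - 1/2)]` descends by ONE Newton–Leibniz move to
`[σ, f₁ + f₂]`, splits by ONE domain-additivity move at `t = 1`, and the two slabs descend by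
Newton–Leibniz moves to `[σ, f₁]` and `[σ, f₂]` (all primitives polynomial in `t`).  Consequence:
integrand additivity is never a load-bearing rule; an additive invariant of the calculus need only
be tested against (1a), (2), (3). [Kontsevich–Zagier 2001, §1.2] [folklore] -/
theorem integrandAddRel_subset_closure :
    KZ.integrandAddRel ⊆ (AddSubgroup.closure (KZ.domainAddRel ∪ KZ.newtonLeibnizRel) :
      Set KZ.FormalRep) := by
  rintro c ⟨n, r, r₁, r₂, h₁, h₂, hadd, rfl⟩
  have h₁₂ : r₂.domain = r₁.domain := h₂.trans h₁.symm
  set S := AddSubgroup.closure (KZ.domainAddRel ∪ KZ.newtonLeibnizRel) with hS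
  have hNL : ∀ {x}, x ∈ KZ.newtonLeibnizRel → x ∈ S := fun hx => AddSubgroup.subset_closure (Or.inr hx)
  have hDA : ∀ {x}, x ∈ KZ.domainAddRel → x ∈ S := fun hx => AddSubgroup.subset_closure (Or.inl hx)
  -- the big band descends to `r`
  have hbig : KZ.of (mixRep r₁ r₂ h₁₂) - KZ.of r ∈ KZ.newtonLeibnizRel := by
    refine ⟨n, mixRep r₁ r₂ h₁₂, r, fun _ => ((0 : ℕ) : ℝ), fun _ => ((2 : ℕ) : ℝ),
      mixPrim r₁ r₂, ?_, isSemialgebraicFunOn_natCast r.isSemialgebraic_domain 0,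
      isSemialgebraicFunOn_natCast r.isSemialgebraic_domain 2, fun _ _ => by norm_num, ?_, ?_, ?_, ?_, rfl⟩
    · exact isSemialgebraicFunOn_mixPrim r₁ r₂ h₁₂
        ((r₁.isSemialgebraic_slabDomain 0).union (r₁.isSemialgebraic_slabDomain 1))
        (fun _ hz => init_mem_of_mem_bigBand r₁ hz)
    · show bigBand r₁ = _
      rw [bigBand_eq, h₁]
      ext z
      simp only [mem_setOf_eq, Nat.cast_zero, Nat.cast_ofNat]
    · intro x _
      simp only [mixPrim, Fin.snoc_last, Fin.init_snoc]
      fun_prop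
    · intro x _ t _
      exact hasDerivAt_mixPrim r₁ r₂ x t
    · intro x hx
      have := hadd hx
      simp only [Pi.add_apply] at this
      simp only [mixPrim, Fin.snoc_last, Fin.init_snoc, this]
      push_cast
      ring
  have key : KZ.of r - KZ.of r₁ - KZ.of r₂ =
      -(KZ.of (mixRep r₁ r₂ h₁₂) - KZ.of r) +
      (KZ.of (mixRep r₁ r₂ h₁₂) - KZ.of (mixSlab r₁ r₂ h₁₂ 0 (by norm_num)) -
        KZ.of (mixSlab r₁ r₂ h₁₂ 1 le_rfl)) +
      (KZ.of (mixSlab r₁ r₂ h₁₂ 0 (by norm_num)) - KZ.of r₁) +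
      (KZ.of (mixSlab r₁ r₂ h₁₂ 1 le_rfl) - KZ.of r₂) := by abel
  rw [SetLike.mem_coe, key]
  exact add_mem (add_mem (add_mem (neg_mem (hNL hbig)) (hDA (of_mixRep_sub_sub_mem r₁ r₂ h₁₂)))
    (hNL (of_mixSlab_zero_sub_mem r₁ r₂ h₁₂))) (hNL (of_mixSlab_one_sub_mem r₁ r₂ h₁₂))

/-- Hence the three move sets (1a), (2), (3) already generate `KZ.relations`. [folklore] -/
theorem relations_eq_closure_three :
    KZ.relations = AddSubgroup.closure (KZ.domainAddRel ∪ KZ.changeOfVariablesRel ∪ KZ.newtonLeibnizRel) := by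
  apply le_antisymm
  · refine (AddSubgroup.closure_le _).mpr ?_
    rintro c (((hc | hc) | hc) | hc)
    · exact AddSubgroup.subset_closure (Or.inl (Or.inl hc))
    · refine AddSubgroup.closure_mono ?_ (integrandAddRel_subset_closure hc)
      rintro x (hx | hx)
      · exact Or.inl (Or.inl hx)
      · exact Or.inr hx
    · exact AddSubgroup.subset_closure (Or.inl (Or.inr hc))
    · exact AddSubgroup.subset_closure (Or.inr hc)
  · refine AddSubgroup.closure_mono ?_
    rintro c ((hc | hc) | hc)
    · exact Or.inl (Or.inl (Or.inl hc))
    · exact Or.inl (Or.inr hc)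
    · exact Or.inr hc

end Summit.KontsevichZagierPeriods.DihedralNormalForm.Negative
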